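import Mathlib
import HarnessLib

/-!
# Strip tiling: an entire function from two families of strip continuations

Topic `Literature/Analysis/Complex`. Everything here is PROVED (no named facts, no definitions).

Setting (one complex variable). A real profile `κ : ℝ → ℝ` is `π`-periodic and symmetric about
the two centres `γⱼ + π/2` (`κ(2γⱼ + π - ω) = κ(ω)`, `j = 1, 2`), and on each base interval
`(γⱼ, γⱼ + π/2)` it is the restriction of a function `Φⱼ` holomorphic on the quarter strip
`0 < Re θ < π/2` in the variable `θ = γⱼ + π/2 - ω`.

* `exists_tiled_continuation`: transporting `Φⱼ` by the two symmetries of `κ` tiles the plane: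
  one gets `Aⱼ`, holomorphic off the vertical lines `Re ω ∈ γⱼ + (π/2)ℤ`, equal to `κ` at the
  real points off that lattice, and inheriting the growth bound of `Φⱼ` — the chart of the strip
  of index `k = ⌊u⌋`, `u = (Re ω - γⱼ)/(π/2)`, is `ω ↦ γⱼ + (k+1)π/2 - ω` (`k` even) or
  `ω ↦ ω - γⱼ - kπ/2` (`k` odd); its real part is `(π/2)(1 - fract u)` resp. `(π/2)·fract u` and
  `|Im|` is unchanged, so a bound `C (e^{|Im θ|}/(sin Re θ · cos Re θ))^β` becomes
  `C (e^{|Im ω|}/(f(1-f)))^β`, `f = fract u`, by Jordan's inequality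
  (`mul_one_sub_le_sin_mul_cos`).
* `eqOn_strip_of_eq_ofReal`: identity theorem on a vertical strip from the real values.
* `exists_entire_of_two_tilings`: if `γ₂ - γ₁ ∉ (π/2)ℤ` the two line families are disjoint;
  `A₁ = A₂` on each common vertical strip, the piecewise function `G` is ENTIRE, `G = κ` on `ℝ`,
  and every abscissa is at fractional distance `≥ δ = ½ · dist((γ₂-γ₁)/(π/2), ℤ) > 0` from one of
  the two lattices, whence `‖G ω‖ ≤ C δ^{-2β} e^{β |Im ω|}`: `G` has exponential type `≤ β`.

The quarter-strip continuations themselves (`Φ(θ) = (cos θ)^{-β} F(tan θ)` from a half-plane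
holomorphic `F`) are produced in `QuarterStripContinuation.lean`; this file does not depend on it.

## References

* R. P. Boas, *Entire Functions* (1954), Ch. 1–2 (exponential type), and the identity theorem
  (Mathlib `AnalyticOnNhd.eqOn_of_preconnected_of_frequently_eq`). [folklore]
-/

noncomputable section

open Complex Set Filter Real Topology

namespace Literature.Analysis.Complex

/-- Jordan's inequality rescaled to `[0,1]`: `x ≤ sin (πx/2)` and `1 - x ≤ cos (πx/2)`, hence
`x (1 - x) ≤ sin (πx/2) cos (πx/2)` for `0 ≤ x ≤ 1`. [folklore] -/
theorem mul_one_sub_le_sin_mul_cos {x : ℝ} (h0 : 0 ≤ x) (h1 : x ≤ 1) :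
    x * (1 - x) ≤ Real.sin (π / 2 * x) * Real.cos (π / 2 * x) := by
  have hsin : ∀ y : ℝ, 0 ≤ y → y ≤ 1 → y ≤ Real.sin (π / 2 * y) := fun y hy0 hy1 => by
    have h := Real.mul_le_sin (x := π / 2 * y) (by positivity) (by nlinarith [Real.pi_pos])
    calc y = 2 / π * (π / 2 * y) := by field_simp
      _ ≤ _ := h
  have hcos : 1 - x ≤ Real.cos (π / 2 * x) := by
    rw [← Real.sin_pi_div_two_sub]
    have h := hsin (1 - x) (by linarith) (by linarith)
    convert h using 2
    ring
  exact mul_le_mul (hsin x h0 h1) hcos (by linarith) ((hsin x h0 h1).trans' h0)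

/-- **Tiling a quarter-strip continuation.** Let `κ : ℝ → ℝ` be `π`-periodic and symmetric
under `ω ↦ 2γ + π - ω`, and let `Φ` be holomorphic on the strip `0 < Re θ < π/2` with
`Φ(θ) = κ(γ + π/2 - θ)` for real `θ ∈ (0, π/2)`. Transporting `Φ` by these two symmetries gives
a function `A`, holomorphic off the vertical lines `Re ω ∈ γ + (π/2)ℤ`, equal to `κ` at the real
points off that lattice, and inheriting the bound of `Φ` (the chart of the strip with index
`k = ⌊u⌋`, `u = (Re ω - γ)/(π/2)`, has real part `(π/2)·fract u` or `(π/2)(1 - fract u)` and the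
same `|Im|`). [folklore] -/
theorem exists_tiled_continuation {κ : ℝ → ℝ} {γ β C : ℝ} {Φ : ℂ → ℂ} (hβ : 0 ≤ β) (hC : 0 ≤ C)
    (hper : ∀ ω, κ (ω + π) = κ ω) (hsymm : ∀ ω, κ (2 * γ + π - ω) = κ ω)
    (hΦ : DifferentiableOn ℂ Φ {θ : ℂ | 0 < θ.re ∧ θ.re < π / 2})
    (hΦκ : ∀ θ : ℝ, 0 < θ → θ < π / 2 → Φ θ = κ (γ + π / 2 - θ))
    (hΦb : ∀ θ : ℂ, 0 < θ.re → θ.re < π / 2 →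
      ‖Φ θ‖ ≤ C * (Real.exp |θ.im| / (Real.sin θ.re * Real.cos θ.re)) ^ β) :
    ∃ A : ℂ → ℂ,
      (∀ ω : ℂ, Int.fract ((ω.re - γ) / (π / 2)) ≠ 0 → DifferentiableAt ℂ A ω) ∧
      (∀ x : ℝ, Int.fract ((x - γ) / (π / 2)) ≠ 0 → A x = κ x) ∧
      ∀ ω : ℂ, Int.fract ((ω.re - γ) / (π / 2)) ≠ 0 →
        ‖A ω‖ ≤ C * (Real.exp |ω.im| /
          (Int.fract ((ω.re - γ) / (π / 2)) * (1 - Int.fract ((ω.re - γ) / (π / 2))))) ^ β := by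
  have hperiodic : Function.Periodic κ π := hper
  have hopen : IsOpen {θ : ℂ | 0 < θ.re ∧ θ.re < π / 2} :=
    (isOpen_lt continuous_const Complex.continuous_re).and
      (isOpen_lt Complex.continuous_re continuous_const)
  -- the normalized abscissa and the charts
  set u : ℂ → ℝ := fun ω => (ω.re - γ) / (π / 2) with hu
  have hu_cont : Continuous u := by simp only [hu]; fun_prop
  set ch : ℤ → ℂ → ℂ := fun k ω =>
    if Even k then ((γ + (k + 1) * (π / 2) : ℝ) : ℂ) - ω else ω - ((γ + k * (π / 2) : ℝ) : ℂ)
    with hch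
  have hch_diff : ∀ k, Differentiable ℂ (ch k) := by
    intro k
    by_cases hk : Even k <;> simp only [hch, hk, ↓reduceIte] <;> fun_prop
  have hch_re : ∀ k ω, (ch k ω).re =
      if Even k then π / 2 * ((k : ℝ) + 1 - u ω) else π / 2 * (u ω - k) := by
    intro k ω
    by_cases hk : Even k <;>
      simp only [hch, hu, hk, ↓reduceIte, Complex.sub_re, Complex.ofReal_re] <;> field_simp <;>
      ring
  have hch_im : ∀ k ω, |(ch k ω).im| = |ω.im| := by
    intro k ω
    by_cases hk : Even k <;> simp [hch, hk, Complex.sub_im, Complex.ofReal_im, abs_neg]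
  have hstrip : ∀ (k : ℤ) (ω : ℂ), (k : ℝ) < u ω → u ω < k + 1 →
      0 < (ch k ω).re ∧ (ch k ω).re < π / 2 := by
    intro k ω hk1 hk2
    rw [hch_re]
    split_ifs
    · constructor <;> nlinarith [Real.pi_pos]
    · constructor <;> nlinarith [Real.pi_pos]
  have hfract : ∀ ω, Int.fract (u ω) ≠ 0 → (⌊u ω⌋ : ℝ) < u ω ∧ u ω < ⌊u ω⌋ + 1 := fun ω h =>
    ⟨lt_of_le_of_ne (Int.floor_le _)
      (Int.fract_pos.1 (lt_of_le_of_ne (Int.fract_nonneg _) (Ne.symm h))).symm,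
      Int.lt_floor_add_one _⟩
  refine ⟨fun ω => Φ (ch ⌊u ω⌋ ω), ?_, ?_, ?_⟩
  · -- holomorphy off the lattice lines
    intro ω₀ hω₀
    obtain ⟨h1, h2⟩ := hfract ω₀ hω₀
    have hev : ∀ᶠ ω in 𝓝 ω₀, ⌊u ω⌋ = ⌊u ω₀⌋ := by
      have : ∀ᶠ ω in 𝓝 ω₀, (⌊u ω₀⌋ : ℝ) < u ω ∧ u ω < ⌊u ω₀⌋ + 1 :=
        hu_cont.continuousAt.eventually (Ioo_mem_nhds h1 h2)
      exact this.mono fun ω hω => Int.floor_eq_iff.2 ⟨hω.1.le, hω.2⟩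
    have heq : (fun ω => Φ (ch ⌊u ω⌋ ω)) =ᶠ[𝓝 ω₀] fun ω => Φ (ch ⌊u ω₀⌋ ω) :=
      hev.mono fun ω hω => by simp only [hω]
    refine DifferentiableAt.congr_of_eventuallyEq ?_ heq
    exact (hΦ.differentiableAt (hopen.mem_nhds (hstrip _ ω₀ h1 h2))).comp ω₀ (hch_diff _ ω₀)
  · -- real values
    intro x hx
    have hux : u x = (x - γ) / (π / 2) := by simp [hu]
    obtain ⟨h1, h2⟩ := hfract x (by rwa [hux])
    rw [hux] at h1 h2
    set k := ⌊(x - γ) / (π / 2)⌋ with hk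
    have hk' : ⌊u x⌋ = k := by rw [hux]
    have h1' : k * (π / 2) < x - γ := (lt_div_iff₀ (by positivity)).1 h1
    have h2' : x - γ < (k + 1) * (π / 2) := (div_lt_iff₀ (by positivity)).1 h2
    show Φ (ch ⌊u x⌋ x) = κ x
    rw [hk']
    rcases Int.even_or_odd k with ⟨m, hm⟩ | ⟨m, hm⟩
    · have hke : Even k := ⟨m, hm⟩
      have hc : ch k x = ((γ + (k + 1) * (π / 2) - x : ℝ) : ℂ) := by
        simp only [hch, hke, ↓reduceIte]; push_cast; ring
      rw [hc, hΦκ _ (by linarith) (by linarith)]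
      congr 1
      have : γ + π / 2 - (γ + (k + 1) * (π / 2) - x) = x - m * π := by
        rw [hm]; push_cast; ring
      rw [this]
      exact hperiodic.sub_int_mul_eq m
    · have hko : ¬Even k := Int.not_even_iff_odd.2 ⟨m, hm⟩
      have hc : ch k x = ((x - γ - k * (π / 2) : ℝ) : ℂ) := by
        simp only [hch, hko, ↓reduceIte]; push_cast; ring
      rw [hc, hΦκ _ (by linarith) (by linarith)]
      congr 1
      have : γ + π / 2 - (x - γ - k * (π / 2)) = 2 * γ + π - (x - m * π) := by
        rw [hm]; push_cast; ring
      rw [this, hsymm]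
      exact hperiodic.sub_int_mul_eq m
  · -- the bound
    intro ω hω
    obtain ⟨h1, h2⟩ := hfract ω hω
    have hf0 : 0 ≤ Int.fract (u ω) := Int.fract_nonneg _
    have hf1 : Int.fract (u ω) < 1 := Int.fract_lt_one _
    have hfk : Int.fract (u ω) = u ω - ⌊u ω⌋ := (Int.self_sub_floor _).symm
    have hfpos : 0 < Int.fract (u ω) := lt_of_le_of_ne hf0 (Ne.symm hω)
    obtain ⟨hs1, hs2⟩ := hstrip _ ω h1 h2
    have hb := hΦb (ch ⌊u ω⌋ ω) hs1 hs2
    rw [hch_im] at hb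
    refine hb.trans ?_
    have hprod : Int.fract (u ω) * (1 - Int.fract (u ω)) ≤
        Real.sin (ch ⌊u ω⌋ ω).re * Real.cos (ch ⌊u ω⌋ ω).re := by
      rw [hch_re]
      split_ifs with hk
      · have h' : (⌊u ω⌋ : ℝ) + 1 - u ω = 1 - Int.fract (u ω) := by rw [hfk]; ring
        rw [h']
        have := mul_one_sub_le_sin_mul_cos (x := 1 - Int.fract (u ω)) (by linarith) (by linarith)
        linarith [this]
      · rw [← hfk]
        exact mul_one_sub_le_sin_mul_cos hf0 hf1.le
    have hpos : 0 < Int.fract (u ω) * (1 - Int.fract (u ω)) := mul_pos hfpos (by linarith)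
    refine mul_le_mul_of_nonneg_left ?_ hC
    refine Real.rpow_le_rpow (div_nonneg (Real.exp_pos _).le (hpos.le.trans hprod)) ?_ hβ
    exact div_le_div_of_nonneg_left (Real.exp_pos _).le hpos hprod

/-- **Uniqueness on a vertical strip from real values.** Two functions holomorphic on the open
vertical strip `p < Re ω < q` that agree at the real points of the strip agree on the whole strip
(identity theorem: the strip is convex hence connected, and its real points accumulate at an
interior real point). [folklore] -/
theorem eqOn_strip_of_eq_ofReal {f g : ℂ → ℂ} {p q : ℝ} (hpq : p < q)
    (hf : DifferentiableOn ℂ f {ω : ℂ | p < ω.re ∧ ω.re < q})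
    (hg : DifferentiableOn ℂ g {ω : ℂ | p < ω.re ∧ ω.re < q})
    (hfg : ∀ t : ℝ, p < t → t < q → f t = g t) :
    EqOn f g {ω : ℂ | p < ω.re ∧ ω.re < q} := by
  have hVo : IsOpen {ω : ℂ | p < ω.re ∧ ω.re < q} :=
    (isOpen_lt continuous_const Complex.continuous_re).and
      (isOpen_lt Complex.continuous_re continuous_const)
  have hVc : IsPreconnected {ω : ℂ | p < ω.re ∧ ω.re < q} :=
    ((convex_halfSpace_re_gt p).inter (convex_halfSpace_re_lt q)).isPreconnected
  obtain ⟨x, hx1, hx2⟩ : ∃ x : ℝ, p < x ∧ x < q := ⟨(p + q) / 2, by linarith, by linarith⟩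
  have hxV : (x : ℂ) ∈ {ω : ℂ | p < ω.re ∧ ω.re < q} := ⟨by simpa using hx1, by simpa using hx2⟩
  refine (hf.analyticOnNhd hVo).eqOn_of_preconnected_of_frequently_eq (hg.analyticOnNhd hVo)
    hVc hxV ?_
  have htend : Tendsto (fun t : ℝ => (t : ℂ)) (𝓝[≠] x) (𝓝[≠] (x : ℂ)) :=
    Complex.continuous_ofReal.continuousWithinAt.tendsto_nhdsWithin
      (fun t ht => by simpa using ht)
  have hev : ∀ᶠ t : ℝ in 𝓝[≠] x, f (t : ℂ) = g (t : ℂ) := by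
    have : ∀ᶠ t in 𝓝 x, p < t ∧ t < q := Ioo_mem_nhds hx1 hx2
    exact (this.filter_mono nhdsWithin_le_nhds).mono fun t ht => hfg t ht.1 ht.2
  exact htend.frequently hev.frequently

/-- **Gluing two strip tilings into an entire function.** Let `A₁`, `A₂` be holomorphic off the
line families `Re ω ∈ γⱼ + (π/2)ℤ` respectively, both equal to `κ` at the real points of their
domains, each bounded by `C (e^{|Im ω|} / (f (1-f)))^β` with `f` the fractional position of `Re ω`
in its period cell. If `γ₂ - γ₁ ∉ (π/2)ℤ` the two line families are disjoint, `A₁ = A₂` on every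
common vertical strip (identity theorem from the real values), the piecewise function is entire,
equals `κ` on `ℝ`, and — since every abscissa is at fractional distance
`≥ δ = ½‖(γ₂-γ₁)/(π/2)‖_{ℝ/ℤ}` from one of the two lattices — it satisfies
`‖G ω‖ ≤ C δ^{-2β} e^{β |Im ω|}`. [folklore] -/
theorem exists_entire_of_two_tilings {κ : ℝ → ℝ} {γ₁ γ₂ β C : ℝ} {A₁ A₂ : ℂ → ℂ}
    (hβ : 0 ≤ β) (hC : 0 ≤ C) (hγ : ∀ k : ℤ, γ₂ - γ₁ ≠ k * (π / 2))
    (hd₁ : ∀ ω : ℂ, Int.fract ((ω.re - γ₁) / (π / 2)) ≠ 0 → DifferentiableAt ℂ A₁ ω)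
    (hκ₁ : ∀ x : ℝ, Int.fract ((x - γ₁) / (π / 2)) ≠ 0 → A₁ x = κ x)
    (hb₁ : ∀ ω : ℂ, Int.fract ((ω.re - γ₁) / (π / 2)) ≠ 0 →
      ‖A₁ ω‖ ≤ C * (Real.exp |ω.im| / (Int.fract ((ω.re - γ₁) / (π / 2)) *
        (1 - Int.fract ((ω.re - γ₁) / (π / 2))))) ^ β)
    (hd₂ : ∀ ω : ℂ, Int.fract ((ω.re - γ₂) / (π / 2)) ≠ 0 → DifferentiableAt ℂ A₂ ω)
    (hκ₂ : ∀ x : ℝ, Int.fract ((x - γ₂) / (π / 2)) ≠ 0 → A₂ x = κ x)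
    (hb₂ : ∀ ω : ℂ, Int.fract ((ω.re - γ₂) / (π / 2)) ≠ 0 →
      ‖A₂ ω‖ ≤ C * (Real.exp |ω.im| / (Int.fract ((ω.re - γ₂) / (π / 2)) *
        (1 - Int.fract ((ω.re - γ₂) / (π / 2))))) ^ β) :
    ∃ G : ℂ → ℂ, Differentiable ℂ G ∧ (∀ ω : ℝ, G ω = κ ω) ∧
      ∃ C' : ℝ, ∀ ω : ℂ, ‖G ω‖ ≤ C' * Real.exp (β * |ω.im|) := by
  set u₁ : ℂ → ℝ := fun ω => (ω.re - γ₁) / (π / 2) with hu₁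
  set u₂ : ℂ → ℝ := fun ω => (ω.re - γ₂) / (π / 2) with hu₂
  have hu₁c : Continuous u₁ := by simp only [hu₁]; fun_prop
  have hu₂c : Continuous u₂ := by simp only [hu₂]; fun_prop
  set c : ℝ := (γ₂ - γ₁) / (π / 2) with hc
  have hcu : ∀ ω, u₁ ω - u₂ ω = c := by
    intro ω; simp only [hu₁, hu₂, hc]; field_simp; ring
  have hcZ : ∀ n : ℤ, c ≠ n := fun n h => hγ n (by
    rw [hc, div_eq_iff (by positivity)] at h; exact h)
  have key1 : ∀ (v : ℝ) (k : ℤ), (k : ℝ) < v → v < k + 1 → Int.fract v ≠ 0 := by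
    intro v k h1 h2
    rw [← Int.self_sub_floor, Int.floor_eq_iff.2 ⟨h1.le, h2⟩]
    exact sub_ne_zero.2 h1.ne'
  have key2 : ∀ v : ℝ, Int.fract v ≠ 0 → (⌊v⌋ : ℝ) < v ∧ v < ⌊v⌋ + 1 := fun v h =>
    ⟨lt_of_le_of_ne (Int.floor_le _)
      (Int.fract_pos.1 (lt_of_le_of_ne (Int.fract_nonneg _) (Ne.symm h))).symm,
      Int.lt_floor_add_one _⟩
  -- agreement on the common domain
  have hagree : ∀ ω, Int.fract (u₁ ω) ≠ 0 → Int.fract (u₂ ω) ≠ 0 → A₁ ω = A₂ ω := by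
    intro ω h1 h2
    obtain ⟨h11, h12⟩ := key2 _ h1
    obtain ⟨h21, h22⟩ := key2 _ h2
    have h11' : ⌊u₁ ω⌋ * (π / 2) < ω.re - γ₁ := (lt_div_iff₀ (by positivity)).1 h11
    have h12' : ω.re - γ₁ < (⌊u₁ ω⌋ + 1) * (π / 2) := (div_lt_iff₀ (by positivity)).1 h12
    have h21' : ⌊u₂ ω⌋ * (π / 2) < ω.re - γ₂ := (lt_div_iff₀ (by positivity)).1 h21
    have h22' : ω.re - γ₂ < (⌊u₂ ω⌋ + 1) * (π / 2) := (div_lt_iff₀ (by positivity)).1 h22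
    set p := max (γ₁ + ⌊u₁ ω⌋ * (π / 2)) (γ₂ + ⌊u₂ ω⌋ * (π / 2)) with hp
    set q := min (γ₁ + (⌊u₁ ω⌋ + 1) * (π / 2)) (γ₂ + (⌊u₂ ω⌋ + 1) * (π / 2)) with hq
    have hpω : p < ω.re := max_lt (by linarith) (by linarith)
    have hqω : ω.re < q := lt_min (by linarith) (by linarith)
    have hin : ∀ ω' : ℂ, p < ω'.re → ω'.re < q →
        Int.fract (u₁ ω') ≠ 0 ∧ Int.fract (u₂ ω') ≠ 0 := by
      intro ω' h1' h2'
      have i1 := (le_max_left _ _).trans_lt h1'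
      have i2 := (le_max_right _ _).trans_lt h1'
      have i3 := h2'.trans_le (min_le_left _ _)
      have i4 := h2'.trans_le (min_le_right _ _)
      refine ⟨key1 (u₁ ω') ⌊u₁ ω⌋ ?_ ?_, key1 (u₂ ω') ⌊u₂ ω⌋ ?_ ?_⟩
      · show (⌊u₁ ω⌋ : ℝ) < (ω'.re - γ₁) / (π / 2)
        rw [lt_div_iff₀ (by positivity)]; linarith
      · show (ω'.re - γ₁) / (π / 2) < ⌊u₁ ω⌋ + 1
        rw [div_lt_iff₀ (by positivity)]; linarith
      · show (⌊u₂ ω⌋ : ℝ) < (ω'.re - γ₂) / (π / 2)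
        rw [lt_div_iff₀ (by positivity)]; linarith
      · show (ω'.re - γ₂) / (π / 2) < ⌊u₂ ω⌋ + 1
        rw [div_lt_iff₀ (by positivity)]; linarith
    refine eqOn_strip_of_eq_ofReal (hpω.trans hqω) (f := A₁) (g := A₂) ?_ ?_ ?_ ⟨hpω, hqω⟩
    · exact fun ω' hω' => (hd₁ ω' (hin ω' hω'.1 hω'.2).1).differentiableWithinAt
    · exact fun ω' hω' => (hd₂ ω' (hin ω' hω'.1 hω'.2).2).differentiableWithinAt
    · intro t ht1 ht2
      obtain ⟨i1, i2⟩ := hin t (by simpa using ht1) (by simpa using ht2)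
      rw [hκ₁ t (by simpa [hu₁] using i1), hκ₂ t (by simpa [hu₂] using i2)]
  -- the two lattices are disjoint
  have hnot : ∀ ω, Int.fract (u₁ ω) = 0 → Int.fract (u₂ ω) ≠ 0 := by
    intro ω h1 h2
    have e1 : u₁ ω - ⌊u₁ ω⌋ = 0 := by rw [Int.self_sub_floor]; exact h1
    have e2 : u₂ ω - ⌊u₂ ω⌋ = 0 := by rw [Int.self_sub_floor]; exact h2
    refine hcZ (⌊u₁ ω⌋ - ⌊u₂ ω⌋) ?_
    rw [← hcu ω]; push_cast; linear_combination e1 - e2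
  refine ⟨fun ω => if Int.fract (u₁ ω) = 0 then A₂ ω else A₁ ω, ?_, ?_, ?_⟩
  · -- entire
    intro ω₀
    by_cases h0 : Int.fract (u₁ ω₀) = 0
    · have h2 := hnot ω₀ h0
      obtain ⟨h21, h22⟩ := key2 _ h2
      have hev : ∀ᶠ ω in 𝓝 ω₀, (⌊u₂ ω₀⌋ : ℝ) < u₂ ω ∧ u₂ ω < ⌊u₂ ω₀⌋ + 1 :=
        hu₂c.continuousAt.eventually (Ioo_mem_nhds h21 h22)
      have heq : (fun ω => if Int.fract (u₁ ω) = 0 then A₂ ω else A₁ ω) =ᶠ[𝓝 ω₀] A₂ := by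
        refine hev.mono fun ω hω => ?_
        have h2ω : Int.fract (u₂ ω) ≠ 0 := key1 _ _ hω.1 hω.2
        by_cases h1ω : Int.fract (u₁ ω) = 0
        · simp only [h1ω, ↓reduceIte]
        · simp only [h1ω, ↓reduceIte, hagree ω h1ω h2ω]
      exact (hd₂ ω₀ h2).congr_of_eventuallyEq heq
    · obtain ⟨h11, h12⟩ := key2 _ h0
      have hev : ∀ᶠ ω in 𝓝 ω₀, (⌊u₁ ω₀⌋ : ℝ) < u₁ ω ∧ u₁ ω < ⌊u₁ ω₀⌋ + 1 :=
        hu₁c.continuousAt.eventually (Ioo_mem_nhds h11 h12)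
      have heq : (fun ω => if Int.fract (u₁ ω) = 0 then A₂ ω else A₁ ω) =ᶠ[𝓝 ω₀] A₁ :=
        hev.mono fun ω hω => by simp only [key1 _ _ hω.1 hω.2, ↓reduceIte]
      exact (hd₁ ω₀ h0).congr_of_eventuallyEq heq
  · -- real values
    intro x
    show (if Int.fract (u₁ x) = 0 then A₂ x else A₁ x) = κ x
    by_cases h0 : Int.fract (u₁ x) = 0
    · rw [if_pos h0]; exact hκ₂ x (by simpa [hu₂] using hnot x h0)
    · rw [if_neg h0]; exact hκ₁ x (by simpa [hu₁] using h0)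
  · -- growth
    set δ := |c - round c| / 2 with hδ
    have hδpos : 0 < δ := half_pos (abs_pos.2 (sub_ne_zero.2 (hcZ _)))
    have hdich : ∀ ω, δ ≤ |u₁ ω - round (u₁ ω)| ∨ δ ≤ |u₂ ω - round (u₂ ω)| := by
      intro ω
      by_contra h
      rw [not_or, not_le, not_le] at h
      obtain ⟨h1, h2⟩ := h
      have hr := round_le c (round (u₁ ω) - round (u₂ ω))
      have htri : |c - ↑(round (u₁ ω) - round (u₂ ω))| ≤
          |u₁ ω - round (u₁ ω)| + |u₂ ω - round (u₂ ω)| := by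
        rw [← hcu ω]
        calc |u₁ ω - u₂ ω - ↑(round (u₁ ω) - round (u₂ ω))|
              = |(u₁ ω - round (u₁ ω)) - (u₂ ω - round (u₂ ω))| := by
                push_cast; ring_nf
          _ ≤ _ := abs_sub _ _
      have : |c - round c| = 2 * δ := by rw [hδ]; ring
      linarith
    have hfr : ∀ v : ℝ, δ ≤ |v - round v| → δ ≤ Int.fract v ∧ δ ≤ 1 - Int.fract v := by
      intro v hv
      rw [abs_sub_round_eq_min] at hv
      exact ⟨hv.trans (min_le_left _ _), hv.trans (min_le_right _ _)⟩
    have hB : ∀ v b : ℝ, δ ≤ Int.fract v → δ ≤ 1 - Int.fract v →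
        C * (Real.exp |b| / (Int.fract v * (1 - Int.fract v))) ^ β ≤
          C / (δ ^ 2) ^ β * Real.exp (β * |b|) := by
      intro v b h1 h2
      have hprod : δ ^ 2 ≤ Int.fract v * (1 - Int.fract v) := by
        rw [sq]; exact mul_le_mul h1 h2 hδpos.le (hδpos.le.trans h1)
      calc C * (Real.exp |b| / (Int.fract v * (1 - Int.fract v))) ^ β
            ≤ C * (Real.exp |b| / δ ^ 2) ^ β := by
              refine mul_le_mul_of_nonneg_left (Real.rpow_le_rpow
                (div_nonneg (Real.exp_pos _).le ((sq_nonneg δ).trans hprod)) ?_ hβ) hC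
              exact div_le_div_of_nonneg_left (Real.exp_pos _).le (by positivity) hprod
        _ = C / (δ ^ 2) ^ β * Real.exp (β * |b|) := by
              rw [Real.div_rpow (Real.exp_pos _).le (by positivity), ← Real.exp_mul,
                mul_comm |b| β]
              ring
    refine ⟨C / (δ ^ 2) ^ β, fun ω => ?_⟩
    show ‖(if Int.fract (u₁ ω) = 0 then A₂ ω else A₁ ω)‖ ≤ _
    rcases hdich ω with h | h
    · obtain ⟨hf1, hf2⟩ := hfr _ h
      have hne : Int.fract (u₁ ω) ≠ 0 := (hδpos.trans_le hf1).ne'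
      rw [if_neg hne]
      exact (hb₁ ω hne).trans (hB _ _ hf1 hf2)
    · obtain ⟨hf1, hf2⟩ := hfr _ h
      have hne : Int.fract (u₂ ω) ≠ 0 := (hδpos.trans_le hf1).ne'
      by_cases h0 : Int.fract (u₁ ω) = 0
      · rw [if_pos h0]; exact (hb₂ ω hne).trans (hB _ _ hf1 hf2)
      · rw [if_neg h0, hagree ω h0 hne]; exact (hb₂ ω hne).trans (hB _ _ hf1 hf2)

end Literature.Analysis.Complex
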